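/-
Copyright (c) 2026. All rights reserved.
Released under Apache 2.0 license as described in the file LICENSE.
-/
import Literature.MathematicalPhysics.QuantumLattice.HubbardSpinReflectionSignRule
import Literature.MathematicalPhysics.QuantumLattice.HubbardCorrelatorCertificateAffine
import HarnessLib

/-!
# The Shen–Qiu–Tian sign structure of the spin correlations in the thermodynamic limit

Infinite-volume ground states `ω` of the half-filled repulsive Hubbard model on `ℤ^d` obtained as
torus limits (`InfVolFermionState.IsTorusLimitOf`: limits of the translation-averaged states of
half-filled ground states `ψ_L` of `fermionTorusGraph d L`, `L` even, `t ≠ 0`, `U > 0`) inherit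
the antiferromagnetic SIGN STRUCTURE of the finite-volume ground states
(`HubbardSpinReflectionSignRule`: Lieb's spin-reflection positivity ⇒ the Shen–Qiu–Tian sign rule
`ε_x ε_y ⟨𝐒_x·𝐒_y⟩ ≥ 0` + SU(2) isotropy): weak inequalities between expectations of local
observables pass to weak-⋆ limits.

* `torusLimit_re_expect_fermionSpinDot_nonneg_of_even` /
  `torusLimit_re_expect_fermionSpinDot_nonpos_of_not_even` — for every torus-limit `ω` of
  half-filled ground states along even sides and all sites `x, y` of a region `Λ`:
  `Re ω(𝐒_x·𝐒_y) ≥ 0` if `Σᵢ (xᵢ - yᵢ)` is even and `≤ 0` if it is odd (§4); in particular every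
  nearest-neighbour correlation is `≤ 0` (`torusLimit_re_expect_fermionSpinDot_add_unitVec_nonpos`)
  and every diagonal next-nearest-neighbour one is `≥ 0`, for EVERY `U > 0`.
* `torusLimit_norm_expect_modulated_spinDot_le` — Néel-sum domination in every finite window:
  for weights `‖a_x‖, ‖b_y‖ ≤ 1` on `Λ`,
  `|ω(Σ_{x,y∈Λ} a_x b_y 𝐒_x·𝐒_y)| ≤ Re ω(Σ_{x,y∈Λ} ε_x ε_y 𝐒_x·𝐒_y)`, `ε_x = (-1)^{‖x‖₁}`:
  every windowed spin structure factor is maximal at `q = (π, …, π)` (§4).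

No divergence of the side sequence and no normalisation of the `ψ_L` are needed: every term of
every translation average carries the sign (translates of ground states are ground states,
`isGroundState_fockTranslate_mulVec`), and the junk values `0` of `torusAvgExpect` satisfy the
weak inequalities too. HONEST SCOPE: signs and an argmax, no magnitudes; nothing is claimed about
long-range order; bipartite (`t′ = 0`) half-filled models only.

## References
* S.-Q. Shen, Z.-M. Qiu, G.-S. Tian, Phys. Rev. Lett. 72 (1994) 1280. [cite: ShenQiuTian1994, Theorem and eqs. (7)–(9)]
* G.-S. Tian, J. Stat. Phys. 116 (2004) 629, §3. [cite: Tian2004, §3]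
* E. H. Lieb, Phys. Rev. Lett. 62 (1989) 1201, Theorem 2. [cite: LiebPRL1989, Theorem 2]
* O. Bratteli, D. W. Robinson, *Operator Algebras and Quantum Statistical Mechanics II*, §6.2.4
  (thermodynamic limit of finite-volume states). [cite: BratteliRobinsonII1997, §6.2.4]
-/

noncomputable section

namespace Literature.MathematicalPhysics.QuantumLattice

open Matrix Finset HubbardWave0 FermionSpinMoment Filter Literature.Probability.LatticeModels
open _root_.Topology
open scoped ComplexOrder

/-! ### §1 Windowed Néel-sum domination along a site map (finite volume) -/

section Generic

variable {Λ : Type*} [LinearOrder Λ] [Fintype Λ]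
variable {G : SimpleGraph Λ} [DecidableRel G.Adj]

/-- **Windowed Néel-sum domination.** For THE half-filled ground state, any index type `κ`, any
site map `e : κ → Λ` and weights `‖a‖, ‖b‖ ≤ 1`:
`|⟨ψ, (Σ_{p,q} a_p b_q 𝐒_{e p}·𝐒_{e q}) ψ⟩| ≤ Re ⟨ψ, (Σ_{p,q} ε_{e p} ε_{e q} 𝐒_{e p}·𝐒_{e q}) ψ⟩`.
[cite: ShenQiuTian1994, Theorem and eqs. (7)–(9)] [cite: Tian2004, §3] -/
theorem norm_expect_modulated_spinDot_le_of_map (hG : G.Connected) (A : Finset Λ)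
    (hA : ∀ x y : Λ, G.Adj x y → (x ∈ A ↔ y ∉ A)) (hcard : Aᶜ.card = A.card)
    {t U : ℝ} (ht : t ≠ 0) (hU : 0 < U) {ψ : Fock (Orb Λ)} (hN : IsNParticle (Fintype.card Λ) ψ)
    (hHψ : hamiltonian G t U *ᵥ ψ = ((groundEnergyAt G t U (Fintype.card Λ) : ℝ) : ℂ) • ψ)
    {κ : Type*} [Fintype κ] (e : κ → Λ) (a b : κ → ℂ) (ha : ∀ p, ‖a p‖ ≤ 1) (hb : ∀ q, ‖b q‖ ≤ 1) :
    ‖star ψ ⬝ᵥ ((∑ p, ∑ q, (a p * b q) • fermionSpinDot (e p) (e q)) *ᵥ ψ)‖ ≤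
      (star ψ ⬝ᵥ ((∑ p, ∑ q, (stagSign A (e p) * stagSign A (e q)) •
        fermionSpinDot (e p) (e q)) *ᵥ ψ)).re := by
  set Gc : κ → κ → ℂ := fun p q => star ψ ⬝ᵥ (fermionSpinDot (e p) (e q) *ᵥ ψ) with hGc
  have hL : star ψ ⬝ᵥ ((∑ p, ∑ q, (a p * b q) • fermionSpinDot (e p) (e q)) *ᵥ ψ) =
      ∑ p, ∑ q, a p * b q * Gc p q := by
    simp only [hGc, Matrix.sum_mulVec, dotProduct_sum, Matrix.smul_mulVec, dotProduct_smul, smul_eq_mul]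
  have hR : (star ψ ⬝ᵥ ((∑ p, ∑ q, (stagSign A (e p) * stagSign A (e q)) •
      fermionSpinDot (e p) (e q)) *ᵥ ψ)).re = ∑ p, ∑ q, (stagSign A (e p) * stagSign A (e q) * Gc p q).re := by
    simp only [hGc, Matrix.sum_mulVec, dotProduct_sum, Matrix.smul_mulVec, dotProduct_smul, smul_eq_mul,
      Complex.re_sum]
  rw [hL, hR]
  refine (norm_sum_le _ _).trans (Finset.sum_le_sum fun p _ => ?_)
  refine (norm_sum_le _ _).trans (Finset.sum_le_sum fun q _ => ?_)
  have hG' := norm_expect_fermionSpinDot_le hG A hA hcard ht hU hN hHψ (e p) (e q)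
  have hab : ‖a p * b q‖ ≤ 1 := by
    rw [norm_mul]
    exact mul_le_one₀ (ha p) (norm_nonneg _) (hb q)
  calc ‖a p * b q * Gc p q‖ = ‖a p * b q‖ * ‖Gc p q‖ := norm_mul _ _
    _ ≤ 1 * ‖Gc p q‖ := by gcongr
    _ ≤ (stagSign A (e p) * stagSign A (e q) * Gc p q).re := by rw [one_mul]; exact hG'

end Generic

/-! ### §2 Parity bookkeeping: the staggered sign of a site of `ℤ^d` pulled back into an even torus -/

section Parity

variable {d L : ℕ} [NeZero L]

/-- (Local to this file, as in every torus-level file: the order-derived `DecidableEq` the generic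
sign-rule theorems and `LiebHalfFilled.hubbardTorus_lieb_hypotheses_pow` are stated with.) [folklore] -/
local instance (priority := high) instDecidableEqFermionTorusSignTL : DecidableEq (FermionTorus d L) :=
  LinearOrder.toDecidableEq

omit [NeZero L] in
/-- `Even (n : ℤ) ↔ Even n`. [folklore] -/
private theorem even_natCast_iff (n : ℕ) : Even (n : ℤ) ↔ Even n := by
  rw [Int.even_iff, Nat.even_iff]; omega

omit [NeZero L] in
/-- With the staggered sign `ε_x = (-1)^{‖x‖₁}` of `ℤ^d`: `ε_x ε_y = +1` if `Σᵢ (xᵢ - yᵢ)` is even,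
`-1` otherwise. [cite: LiebPRL1989, Theorem 2] -/
theorem neg_one_pow_l1_mul_neg_one_pow_l1 (x y : Site d) :
    (-1 : ℂ) ^ (∑ i, (x i).natAbs) * (-1 : ℂ) ^ (∑ i, (y i).natAbs) =
      if Even (∑ i, (x i - y i)) then 1 else -1 := by
  rw [← pow_add]
  have hpar : Even (∑ i, (x i).natAbs + ∑ i, (y i).natAbs) ↔ Even (∑ i, (x i - y i)) := by
    rw [← even_natCast_iff, Nat.cast_add, Nat.cast_sum, Nat.cast_sum]
    have hx : Even ((∑ i, ((x i).natAbs : ℤ)) - ∑ i, x i) := by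
      rw [← Finset.sum_sub_distrib]
      refine Finset.even_sum _ fun i _ => ?_
      rcases Int.natAbs_eq (x i) with h | h
      · rw [← h, sub_self]; exact Even.zero
      · have : ((x i).natAbs : ℤ) - x i = 2 * ((x i).natAbs : ℤ) := by linarith
        rw [this]; exact even_two_mul _
    have hy : Even ((∑ i, ((y i).natAbs : ℤ)) - ∑ i, y i) := by
      rw [← Finset.sum_sub_distrib]
      refine Finset.even_sum _ fun i _ => ?_
      rcases Int.natAbs_eq (y i) with h | h
      · rw [← h, sub_self]; exact Even.zero
      · have : ((y i).natAbs : ℤ) - y i = 2 * ((y i).natAbs : ℤ) := by linarith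
        rw [this]; exact even_two_mul _
    rw [Int.even_sub] at hx hy
    rw [Int.even_add, hx, hy, ← Int.even_sub, Finset.sum_sub_distrib]
  split_ifs with h
  · exact (neg_one_pow_eq_one_iff_even (by norm_num : (-1 : ℂ) ≠ 1)).2 (hpar.2 h)
  · exact ((Nat.not_even_iff_odd.1 fun h' => h (hpar.1 h')).neg_one_pow : (-1 : ℂ) ^ _ = -1)

/-- The coordinates of a site of a region pulled back into the torus of side `L` are the
residues `xᵢ mod L`. [cite: FriedliVelenik2017, §3.1] -/
theorem natCast_ofLex_toTorusEmb_pt {Λ : Finset (Site d)} (h : Set.InjOn (Torus.proj (d := d) L) ↑Λ)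
    {x : Site d} (hx : x ∈ Λ) (i : Fin d) :
    ((ofLex (PolySite.toTorusEmb L h (PolySite.pt x hx)) i : ℕ) : ℤ) = x i % L := by
  rw [PolySite.toTorusEmb_apply, FermionTorus.ofLex_ofTorusSite_apply, PolySite.ofLex_coe_pt]
  exact ZMod.val_intCast (x i)

/-- For even `L`, `Σᵢ (xᵢ mod L) ≡ Σᵢ xᵢ (mod 2)`: the staggering sign of `ℤ^d` descends to the
even torus. [cite: LiebPRL1989, Theorem 2] [cite: FriedliVelenik2017, §3.1] -/
theorem even_sum_ofLex_toTorusEmb_sub (hL : Even L) {Λ : Finset (Site d)}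
    (h : Set.InjOn (Torus.proj (d := d) L) ↑Λ) {x : Site d} (hx : x ∈ Λ) :
    Even ((∑ i, ((ofLex (PolySite.toTorusEmb L h (PolySite.pt x hx)) i : ℕ) : ℤ)) - ∑ i, x i) := by
  rw [← Finset.sum_sub_distrib]
  refine Finset.even_sum _ fun i _ => ?_
  rw [natCast_ofLex_toTorusEmb_pt h hx i, Int.emod_def]
  obtain ⟨k, hk⟩ := hL
  exact ⟨-((k : ℤ) * (x i / L)), by rw [hk]; push_cast; ring⟩

omit [NeZero L] in
/-- `stagSign` of the colour class `{ε = +1}` of the torus is the torus staggering sign.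
[cite: LiebPRL1989, Theorem 2] -/
theorem stagSign_filter_torusStagger (z : FermionTorus d L) :
    stagSign (univ.filter fun w : FermionTorus d L => torusStagger w = 1) z =
      (((torusStagger z : ℤˣ) : ℤ) : ℂ) := by
  by_cases hz : torusStagger z = 1
  · have hmem : z ∈ (univ.filter fun w : FermionTorus d L => torusStagger w = 1) :=
      mem_filter.2 ⟨mem_univ _, hz⟩
    rw [stagSign_of_mem hmem, hz, Units.val_one, Int.cast_one]
  · have hz' : torusStagger z = -1 := (Int.units_eq_one_or (torusStagger z)).resolve_left hz
    have hnot : z ∈ (univ.filter fun w : FermionTorus d L => torusStagger w = 1)ᶜ :=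
      mem_compl.2 fun hm => hz (mem_filter.1 hm).2
    rw [stagSign_of_mem_compl hnot, hz', Units.val_neg, Units.val_one, Int.cast_neg, Int.cast_one]

/-- **The torus staggering signs of two pulled-back sites multiply to `ε_x ε_y`** (`L` even).
[cite: LiebPRL1989, Theorem 2] -/
theorem stagSign_toTorusEmb_mul (hL : Even L) {Λ : Finset (Site d)}
    (h : Set.InjOn (Torus.proj (d := d) L) ↑Λ) {x y : Site d} (hx : x ∈ Λ) (hy : y ∈ Λ) :
    stagSign (univ.filter fun w : FermionTorus d L => torusStagger w = 1)
        (PolySite.toTorusEmb L h (PolySite.pt x hx)) *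
      stagSign (univ.filter fun w : FermionTorus d L => torusStagger w = 1)
        (PolySite.toTorusEmb L h (PolySite.pt y hy)) =
      (-1 : ℂ) ^ (∑ i, (x i).natAbs) * (-1 : ℂ) ^ (∑ i, (y i).natAbs) := by
  rw [stagSign_filter_torusStagger, stagSign_filter_torusStagger, neg_one_pow_l1_mul_neg_one_pow_l1]
  set X := PolySite.toTorusEmb L h (PolySite.pt x hx) with hX
  set Y := PolySite.toTorusEmb L h (PolySite.pt y hy) with hY
  have hprod : torusStagger X * torusStagger Y =
      (-1) ^ (∑ i, (ofLex X i : ℕ) + ∑ i, (ofLex Y i : ℕ)) := by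
    rw [torusStagger_apply, torusStagger_apply]
    exact (pow_add _ _ _).symm
  have hpar : Even (∑ i, (ofLex X i : ℕ) + ∑ i, (ofLex Y i : ℕ)) ↔ Even (∑ i, (x i - y i)) := by
    rw [← even_natCast_iff, Nat.cast_add, Nat.cast_sum, Nat.cast_sum]
    have hx' := even_sum_ofLex_toTorusEmb_sub hL h hx
    have hy' := even_sum_ofLex_toTorusEmb_sub hL h hy
    rw [← hX] at hx'
    rw [← hY] at hy'
    rw [Int.even_sub] at hx' hy'
    rw [Int.even_add, hx', hy', ← Int.even_sub, Finset.sum_sub_distrib]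
  rw [← Int.cast_mul, ← Units.val_mul, hprod]
  split_ifs with he
  · have h1 : (-1 : ℤˣ) ^ (∑ i, (ofLex X i : ℕ) + ∑ i, (ofLex Y i : ℕ)) = 1 :=
      (neg_one_pow_eq_one_iff_even (by decide : (-1 : ℤˣ) ≠ 1)).2 (hpar.2 he)
    rw [h1, Units.val_one, Int.cast_one]
  · have h1 : (-1 : ℤˣ) ^ (∑ i, (ofLex X i : ℕ) + ∑ i, (ofLex Y i : ℕ)) = -1 :=
      (Nat.not_even_iff_odd.1 fun h' => he (hpar.1 h')).neg_one_pow
    rw [h1, Units.val_neg, Units.val_one, Int.cast_neg, Int.cast_one]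

end Parity

/-! ### §3 Finite even tori: signed correlations of pulled-back sites, and their translation averages -/

section Torus

variable {d L : ℕ} [NeZero L]

/-- (Local to this section, as above.) [folklore] -/
local instance (priority := high) instDecidableEqFermionTorusSignTL' : DecidableEq (FermionTorus d L) :=
  LinearOrder.toDecidableEq

omit [NeZero L] in
/-- `|(ℤ/Lℤ)^d| = L^d` for the fermionic torus. [folklore] -/
private theorem card_fermionTorus_pow : Fintype.card (FermionTorus d L) = L ^ d := by
  simp only [FermionTorus, Fintype.card_lex, Fintype.card_fun, Fintype.card_fin]

/-- **`ε_x ε_y ⟨φ, 𝐒_x·𝐒_y φ⟩ ≥ 0` for pulled-back sites**, every half-filled ground state `φ` of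
`fermionTorusGraph d L` (`d ≥ 1`, `L` even, `t ≠ 0`, `U > 0`). [cite: ShenQiuTian1994, Theorem and eqs. (7)–(9)] -/
theorem groundState_stagger_mul_expect_fermionSpinDot_nonneg (hd : 0 < d) (hL : Even L)
    {t U : ℝ} (ht : t ≠ 0) (hU : 0 < U) {Λ : Finset (Site d)}
    (h : Set.InjOn (Torus.proj (d := d) L) ↑Λ) {x y : Site d} (hx : x ∈ Λ) (hy : y ∈ Λ)
    {φ : Fock (Orb (FermionTorus d L))}
    (hφ : IsGroundState (hamiltonian (fermionTorusGraph d L) t U) (L ^ d) φ) :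
    0 ≤ (-1 : ℂ) ^ (∑ i, (x i).natAbs) * (-1 : ℂ) ^ (∑ i, (y i).natAbs) *
      expect (fermionEmbed (PolySite.toTorusEmb L h) (fermionSpinDot (PolySite.pt x hx) (PolySite.pt y hy))) φ := by
  obtain ⟨hG, hA, hcard⟩ := LiebHalfFilled.hubbardTorus_lieb_hypotheses_pow (L := L) hd hL
  obtain ⟨hN, -, hHφ⟩ := hφ
  rw [← card_fermionTorus_pow] at hN hHφ
  rw [fermionEmbed_fermionSpinDot, ← stagSign_toTorusEmb_mul hL h hx hy]
  exact stagSign_mul_expect_fermionSpinDot_nonneg hG _ hA hcard ht hU hN hHφ _ _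

/-- Signed form: `Re ⟨φ, 𝐒_x·𝐒_y φ⟩ ≥ 0` for `Σᵢ(xᵢ - yᵢ)` even, `≤ 0` for odd.
[cite: ShenQiuTian1994, Theorem and eqs. (7)–(9)] -/
theorem groundState_re_expect_fermionSpinDot_sign (hd : 0 < d) (hL : Even L)
    {t U : ℝ} (ht : t ≠ 0) (hU : 0 < U) {Λ : Finset (Site d)}
    (h : Set.InjOn (Torus.proj (d := d) L) ↑Λ) {x y : Site d} (hx : x ∈ Λ) (hy : y ∈ Λ)
    {φ : Fock (Orb (FermionTorus d L))}
    (hφ : IsGroundState (hamiltonian (fermionTorusGraph d L) t U) (L ^ d) φ) :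
    (Even (∑ i, (x i - y i)) → 0 ≤ (expect (fermionEmbed (PolySite.toTorusEmb L h)
        (fermionSpinDot (PolySite.pt x hx) (PolySite.pt y hy))) φ).re) ∧
    (¬ Even (∑ i, (x i - y i)) → (expect (fermionEmbed (PolySite.toTorusEmb L h)
        (fermionSpinDot (PolySite.pt x hx) (PolySite.pt y hy))) φ).re ≤ 0) := by
  have key := groundState_stagger_mul_expect_fermionSpinDot_nonneg hd hL ht hU h hx hy hφ
  rw [neg_one_pow_l1_mul_neg_one_pow_l1] at key
  constructor
  · intro he
    rw [if_pos he, one_mul] at key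
    exact (Complex.nonneg_iff.mp key).1
  · intro ho
    rw [if_neg ho, neg_one_mul] at key
    have := (Complex.nonneg_iff.mp key).1
    rw [Complex.neg_re] at this
    linarith

/-- **Windowed Néel-sum domination for pulled-back windows**, every half-filled ground state.
[cite: ShenQiuTian1994, Theorem and eqs. (7)–(9)] [cite: Tian2004, §3] -/
theorem groundState_norm_expect_modulated_spinDot_le (hd : 0 < d) (hL : Even L)
    {t U : ℝ} (ht : t ≠ 0) (hU : 0 < U) {Λ : Finset (Site d)}
    (h : Set.InjOn (Torus.proj (d := d) L) ↑Λ) (a b : PolySite Λ → ℂ)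
    (ha : ∀ p, ‖a p‖ ≤ 1) (hb : ∀ q, ‖b q‖ ≤ 1) {φ : Fock (Orb (FermionTorus d L))}
    (hφ : IsGroundState (hamiltonian (fermionTorusGraph d L) t U) (L ^ d) φ) :
    ‖expect (fermionEmbed (PolySite.toTorusEmb L h) (∑ p, ∑ q, (a p * b q) • fermionSpinDot p q)) φ‖ ≤
      (expect (fermionEmbed (PolySite.toTorusEmb L h) (∑ p, ∑ q,
        ((-1 : ℂ) ^ (∑ i, (ofLex p.1 i).natAbs) * (-1 : ℂ) ^ (∑ i, (ofLex q.1 i).natAbs)) • fermionSpinDot p q)) φ).re := by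
  obtain ⟨hG, hA, hcard⟩ := LiebHalfFilled.hubbardTorus_lieb_hypotheses_pow (L := L) hd hL
  obtain ⟨hN, -, hHφ⟩ := hφ
  rw [← card_fermionTorus_pow] at hN hHφ
  simp only [map_sum, map_smul, fermionEmbed_fermionSpinDot]
  have hw : ∀ p q : PolySite Λ,
      (-1 : ℂ) ^ (∑ i, (ofLex p.1 i).natAbs) * (-1 : ℂ) ^ (∑ i, (ofLex q.1 i).natAbs) =
      stagSign (univ.filter fun w : FermionTorus d L => torusStagger w = 1) (PolySite.toTorusEmb L h p) *
        stagSign (univ.filter fun w : FermionTorus d L => torusStagger w = 1) (PolySite.toTorusEmb L h q) :=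
    fun p q => (stagSign_toTorusEmb_mul hL h (PolySite.ofLex_mem p) (PolySite.ofLex_mem q)).symm
  simp_rw [hw]
  exact norm_expect_modulated_spinDot_le_of_map hG _ hA hcard ht hU hN hHφ (PolySite.toTorusEmb L h) a b ha hb

/-- **Translation averages keep the sign**: for every side `L` (junk values included) and every
half-filled ground state `φ` (used only when `L ≠ 0` and `Λ` fits), `Re` of the averaged torus
expectation of `𝐒_x·𝐒_y` is `≥ 0` / `≤ 0` according to the parity of `Σᵢ(xᵢ - yᵢ)`.
[cite: ShenQiuTian1994, Theorem and eqs. (7)–(9)] -/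
theorem groundState_re_torusAvgExpectAt_fermionSpinDot_sign (hd : 0 < d) (hL : Even L)
    {t U : ℝ} (ht : t ≠ 0) (hU : 0 < U) {Λ : Finset (Site d)} {x y : Site d} (hx : x ∈ Λ) (hy : y ∈ Λ)
    {φ : Fock (Orb (FermionTorus d L))}
    (hφ : IsGroundState (hamiltonian (fermionTorusGraph d L) t U) (L ^ d) φ) :
    (Even (∑ i, (x i - y i)) →
      0 ≤ (torusAvgExpectAt L Λ (fermionSpinDot (PolySite.pt x hx) (PolySite.pt y hy)) φ).re) ∧
    (¬ Even (∑ i, (x i - y i)) →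
      (torusAvgExpectAt L Λ (fermionSpinDot (PolySite.pt x hx) (PolySite.pt y hy)) φ).re ≤ 0) := by
  by_cases h : Set.InjOn (Torus.proj (d := d) L) ↑Λ
  · rw [torusAvgExpectAt_of_injOn L h, card_torusSite, ← Complex.ofReal_natCast, ← Complex.ofReal_inv,
      Complex.re_ofReal_mul, Complex.re_sum]
    have hpos : (0 : ℝ) ≤ (((L ^ d : ℕ) : ℝ))⁻¹ := inv_nonneg.2 (Nat.cast_nonneg _)
    constructor
    · intro he
      refine mul_nonneg hpos (Finset.sum_nonneg fun v _ => ?_)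
      exact (groundState_re_expect_fermionSpinDot_sign hd hL ht hU h hx hy
        (isGroundState_fockTranslate_mulVec t U v hφ)).1 he
    · intro ho
      refine mul_nonpos_of_nonneg_of_nonpos hpos (Finset.sum_nonpos fun v _ => ?_)
      exact (groundState_re_expect_fermionSpinDot_sign hd hL ht hU h hx hy
        (isGroundState_fockTranslate_mulVec t U v hφ)).2 ho
  · rw [torusAvgExpectAt_of_not_injOn L h, Complex.zero_re]
    exact ⟨fun _ => le_rfl, fun _ => le_rfl⟩

/-- Translation averages keep the windowed Néel-sum domination. [cite: ShenQiuTian1994, Theorem and eqs. (7)–(9)] -/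
theorem groundState_norm_torusAvgExpectAt_modulated_spinDot_le (hd : 0 < d) (hL : Even L)
    {t U : ℝ} (ht : t ≠ 0) (hU : 0 < U) {Λ : Finset (Site d)} (a b : PolySite Λ → ℂ)
    (ha : ∀ p, ‖a p‖ ≤ 1) (hb : ∀ q, ‖b q‖ ≤ 1) {φ : Fock (Orb (FermionTorus d L))}
    (hφ : IsGroundState (hamiltonian (fermionTorusGraph d L) t U) (L ^ d) φ) :
    ‖torusAvgExpectAt L Λ (∑ p, ∑ q, (a p * b q) • fermionSpinDot p q) φ‖ ≤
      (torusAvgExpectAt L Λ (∑ p, ∑ q,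
        ((-1 : ℂ) ^ (∑ i, (ofLex p.1 i).natAbs) * (-1 : ℂ) ^ (∑ i, (ofLex q.1 i).natAbs)) • fermionSpinDot p q) φ).re := by
  by_cases h : Set.InjOn (Torus.proj (d := d) L) ↑Λ
  · rw [torusAvgExpectAt_of_injOn L h, torusAvgExpectAt_of_injOn L h, card_torusSite,
      ← Complex.ofReal_natCast, ← Complex.ofReal_inv, Complex.re_ofReal_mul, Complex.re_sum, norm_mul,
      Complex.norm_real, Real.norm_of_nonneg (inv_nonneg.2 (Nat.cast_nonneg _))]
    refine mul_le_mul_of_nonneg_left ((norm_sum_le _ _).trans (Finset.sum_le_sum fun v _ => ?_))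
      (inv_nonneg.2 (Nat.cast_nonneg _))
    exact groundState_norm_expect_modulated_spinDot_le hd hL ht hU h a b ha hb
      (isGroundState_fockTranslate_mulVec t U v hφ)
  · rw [torusAvgExpectAt_of_not_injOn L h, torusAvgExpectAt_of_not_injOn L h, norm_zero, Complex.zero_re]

end Torus

/-! ### §4 The thermodynamic limit -/

section Limit

variable {d : ℕ}

/-- Side-`L` form of the signed average (junk value at `L = 0` included). [cite: ShenQiuTian1994, Theorem and eqs. (7)–(9)] -/
theorem groundState_re_torusAvgExpect_fermionSpinDot_sign (hd : 0 < d) {L : ℕ} (hL : Even L)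
    {t U : ℝ} (ht : t ≠ 0) (hU : 0 < U) {Λ : Finset (Site d)} {x y : Site d} (hx : x ∈ Λ) (hy : y ∈ Λ)
    {φ : Fock (Orb (FermionTorus d L))}
    (hφ : IsGroundState (hamiltonian (fermionTorusGraph d L) t U) (L ^ d) φ) :
    (Even (∑ i, (x i - y i)) →
      0 ≤ (torusAvgExpect L Λ (fermionSpinDot (PolySite.pt x hx) (PolySite.pt y hy)) φ).re) ∧
    (¬ Even (∑ i, (x i - y i)) →
      (torusAvgExpect L Λ (fermionSpinDot (PolySite.pt x hx) (PolySite.pt y hy)) φ).re ≤ 0) := by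
  rcases Nat.eq_zero_or_pos L with rfl | hLpos
  · rw [torusAvgExpect_zero, Complex.zero_re]
    exact ⟨fun _ => le_rfl, fun _ => le_rfl⟩
  · haveI : NeZero L := NeZero.of_pos hLpos
    rw [torusAvgExpect_eq]
    exact groundState_re_torusAvgExpectAt_fermionSpinDot_sign hd hL ht hU hx hy hφ

/-- Side-`L` form of the averaged domination. [cite: ShenQiuTian1994, Theorem and eqs. (7)–(9)] -/
theorem groundState_norm_torusAvgExpect_modulated_spinDot_le (hd : 0 < d) {L : ℕ} (hL : Even L)
    {t U : ℝ} (ht : t ≠ 0) (hU : 0 < U) {Λ : Finset (Site d)} (a b : PolySite Λ → ℂ)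
    (ha : ∀ p, ‖a p‖ ≤ 1) (hb : ∀ q, ‖b q‖ ≤ 1) {φ : Fock (Orb (FermionTorus d L))}
    (hφ : IsGroundState (hamiltonian (fermionTorusGraph d L) t U) (L ^ d) φ) :
    ‖torusAvgExpect L Λ (∑ p, ∑ q, (a p * b q) • fermionSpinDot p q) φ‖ ≤
      (torusAvgExpect L Λ (∑ p, ∑ q,
        ((-1 : ℂ) ^ (∑ i, (ofLex p.1 i).natAbs) * (-1 : ℂ) ^ (∑ i, (ofLex q.1 i).natAbs)) • fermionSpinDot p q) φ).re := by
  rcases Nat.eq_zero_or_pos L with rfl | hLpos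
  · rw [torusAvgExpect_zero, torusAvgExpect_zero, norm_zero, Complex.zero_re]
  · haveI : NeZero L := NeZero.of_pos hLpos
    rw [torusAvgExpect_eq, torusAvgExpect_eq]
    exact groundState_norm_torusAvgExpectAt_modulated_spinDot_le hd hL ht hU a b ha hb hφ

/-- **AF sign structure of torus-limit half-filled ground states, same-sublattice part**: for every
torus limit `ω` of half-filled ground states of `fermionTorusGraph d L` along even sides
(`d ≥ 1`, `t ≠ 0`, `U > 0`) and all sites `x, y ∈ Λ` with `Σᵢ (xᵢ - yᵢ)` even,
`Re ω(𝐒_x·𝐒_y) ≥ 0`. [cite: ShenQiuTian1994, Theorem and eqs. (7)–(9)] [cite: Tian2004, §3] -/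
theorem torusLimit_re_expect_fermionSpinDot_nonneg_of_even (hd : 0 < d)
    {t U : ℝ} (ht : t ≠ 0) (hU : 0 < U) {Ls : ℕ → ℕ} (hev : ∀ j, Even (Ls j))
    {ψ : ∀ L, Fock (Orb (FermionTorus d L))}
    (hψ : ∀ j, IsGroundState (hamiltonian (fermionTorusGraph d (Ls j)) t U) (Ls j ^ d) (ψ (Ls j)))
    {ω : InfVolFermionState d} (hω : ω.IsTorusLimitOf ψ Ls)
    {Λ : Finset (Site d)} {x y : Site d} (hx : x ∈ Λ) (hy : y ∈ Λ) (hxy : Even (∑ i, (x i - y i))) :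
    0 ≤ (ω.expect Λ (fermionSpinDot (PolySite.pt x hx) (PolySite.pt y hy))).re := by
  have hlim : Tendsto (fun j => (torusAvgExpect (Ls j) Λ
      (fermionSpinDot (PolySite.pt x hx) (PolySite.pt y hy)) (ψ (Ls j))).re) atTop
      (𝓝 (ω.expect Λ (fermionSpinDot (PolySite.pt x hx) (PolySite.pt y hy))).re) :=
    (Complex.continuous_re.tendsto _).comp (hω Λ _)
  exact ge_of_tendsto' hlim fun j =>
    (groundState_re_torusAvgExpect_fermionSpinDot_sign hd (hev j) ht hU hx hy (hψ j)).1 hxy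

/-- **AF sign structure of torus-limit half-filled ground states, opposite-sublattice part**:
`Σᵢ (xᵢ - yᵢ)` odd ⇒ `Re ω(𝐒_x·𝐒_y) ≤ 0`. [cite: ShenQiuTian1994, Theorem and eqs. (7)–(9)] [cite: Tian2004, §3] -/
theorem torusLimit_re_expect_fermionSpinDot_nonpos_of_not_even (hd : 0 < d)
    {t U : ℝ} (ht : t ≠ 0) (hU : 0 < U) {Ls : ℕ → ℕ} (hev : ∀ j, Even (Ls j))
    {ψ : ∀ L, Fock (Orb (FermionTorus d L))}
    (hψ : ∀ j, IsGroundState (hamiltonian (fermionTorusGraph d (Ls j)) t U) (Ls j ^ d) (ψ (Ls j)))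
    {ω : InfVolFermionState d} (hω : ω.IsTorusLimitOf ψ Ls)
    {Λ : Finset (Site d)} {x y : Site d} (hx : x ∈ Λ) (hy : y ∈ Λ) (hxy : ¬ Even (∑ i, (x i - y i))) :
    (ω.expect Λ (fermionSpinDot (PolySite.pt x hx) (PolySite.pt y hy))).re ≤ 0 := by
  have hlim : Tendsto (fun j => (torusAvgExpect (Ls j) Λ
      (fermionSpinDot (PolySite.pt x hx) (PolySite.pt y hy)) (ψ (Ls j))).re) atTop
      (𝓝 (ω.expect Λ (fermionSpinDot (PolySite.pt x hx) (PolySite.pt y hy))).re) :=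
    (Complex.continuous_re.tendsto _).comp (hω Λ _)
  exact le_of_tendsto' hlim fun j =>
    (groundState_re_torusAvgExpect_fermionSpinDot_sign hd (hev j) ht hU hx hy (hψ j)).2 hxy

/-- **Every nearest-neighbour spin correlation of a torus-limit half-filled ground state is
antiferromagnetic in sign, for every `U > 0`**: `Re ω(𝐒_x·𝐒_{x+eᵢ}) ≤ 0`.
[cite: ShenQiuTian1994, Theorem and eqs. (7)–(9)] [cite: Tian2004, §3] -/
theorem torusLimit_re_expect_fermionSpinDot_add_unitVec_nonpos (hd : 0 < d)
    {t U : ℝ} (ht : t ≠ 0) (hU : 0 < U) {Ls : ℕ → ℕ} (hev : ∀ j, Even (Ls j))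
    {ψ : ∀ L, Fock (Orb (FermionTorus d L))}
    (hψ : ∀ j, IsGroundState (hamiltonian (fermionTorusGraph d (Ls j)) t U) (Ls j ^ d) (ψ (Ls j)))
    {ω : InfVolFermionState d} (hω : ω.IsTorusLimitOf ψ Ls)
    {Λ : Finset (Site d)} {x : Site d} (i : Fin d) (hx : x ∈ Λ) (hxe : x + unitVec i ∈ Λ) :
    (ω.expect Λ (fermionSpinDot (PolySite.pt x hx) (PolySite.pt (x + unitVec i) hxe))).re ≤ 0 := by
  refine torusLimit_re_expect_fermionSpinDot_nonpos_of_not_even hd ht hU hev hψ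
    hω hx hxe ?_
  have hsum : ∑ j, (x j - (x + unitVec i) j) = -1 := by
    have hj : ∀ j, x j - (x + unitVec i) j = -((unitVec i : Site d) j) := fun j => by
      rw [Pi.add_apply]; ring
    have h1 : ∑ j, (unitVec i : Site d) j = 1 := by
      show ∑ j, (Pi.single i (1 : ℤ) : Site d) j = 1
      rw [Finset.sum_pi_single', if_pos (Finset.mem_univ _)]
    simp_rw [hj, Finset.sum_neg_distrib, h1]
  rw [hsum]
  exact Int.not_even_iff_odd.2 odd_neg_one

/-- **Windowed Néel-sum domination for torus-limit half-filled ground states**: for every finite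
window `Λ ⊂ ℤ^d` and all weights `‖a_x‖, ‖b_y‖ ≤ 1` on it,
`|ω(Σ_{x,y∈Λ} a_x b_y 𝐒_x·𝐒_y)| ≤ Re ω(Σ_{x,y∈Λ} ε_x ε_y 𝐒_x·𝐒_y)`, `ε_x = (-1)^{‖x‖₁}`: every
windowed spin structure factor `S_Λ(q)` (`a_x = e^{iq·x}`, `b_y = e^{-iq·y}`) is bounded by the
staggered one `S_Λ(π,…,π)`, for every `U > 0`. [cite: ShenQiuTian1994, Theorem and eqs. (7)–(9)] [cite: Tian2004, §3] -/
theorem torusLimit_norm_expect_modulated_spinDot_le (hd : 0 < d)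
    {t U : ℝ} (ht : t ≠ 0) (hU : 0 < U) {Ls : ℕ → ℕ} (hev : ∀ j, Even (Ls j))
    {ψ : ∀ L, Fock (Orb (FermionTorus d L))}
    (hψ : ∀ j, IsGroundState (hamiltonian (fermionTorusGraph d (Ls j)) t U) (Ls j ^ d) (ψ (Ls j)))
    {ω : InfVolFermionState d} (hω : ω.IsTorusLimitOf ψ Ls)
    (Λ : Finset (Site d)) (a b : PolySite Λ → ℂ) (ha : ∀ p, ‖a p‖ ≤ 1) (hb : ∀ q, ‖b q‖ ≤ 1) :
    ‖ω.expect Λ (∑ p, ∑ q, (a p * b q) • fermionSpinDot p q)‖ ≤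
      (ω.expect Λ (∑ p, ∑ q,
        ((-1 : ℂ) ^ (∑ i, (ofLex p.1 i).natAbs) * (-1 : ℂ) ^ (∑ i, (ofLex q.1 i).natAbs)) • fermionSpinDot p q)).re := by
  have hlimA : Tendsto (fun j => ‖torusAvgExpect (Ls j) Λ (∑ p, ∑ q, (a p * b q) • fermionSpinDot p q)
      (ψ (Ls j))‖) atTop (𝓝 ‖ω.expect Λ (∑ p, ∑ q, (a p * b q) • fermionSpinDot p q)‖) :=
    (continuous_norm.tendsto _).comp (hω Λ _)
  have hlimB : Tendsto (fun j => (torusAvgExpect (Ls j) Λ (∑ p, ∑ q,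
      ((-1 : ℂ) ^ (∑ i, (ofLex p.1 i).natAbs) * (-1 : ℂ) ^ (∑ i, (ofLex q.1 i).natAbs)) • fermionSpinDot p q) (ψ (Ls j))).re) atTop
      (𝓝 (ω.expect Λ (∑ p, ∑ q,
        ((-1 : ℂ) ^ (∑ i, (ofLex p.1 i).natAbs) * (-1 : ℂ) ^ (∑ i, (ofLex q.1 i).natAbs)) • fermionSpinDot p q)).re) :=
    (Complex.continuous_re.tendsto _).comp (hω Λ _)
  exact le_of_tendsto_of_tendsto' hlimA hlimB fun j =>
    groundState_norm_torusAvgExpect_modulated_spinDot_le hd (hev j) ht hU a b ha hb (hψ j)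

/-- **Existence + sign structure packaged** (`d ≥ 1`, `t ≠ 0`, `U > 0`): there is a torus-limit
half-filled ground state, and EVERY such limit along even sides has antiferromagnetic
nearest-neighbour spin correlations. [cite: ShenQiuTian1994, Theorem and eqs. (7)–(9)] [cite: BratteliRobinsonII1997, §6.2.4] -/
theorem exists_isTorusLimitOf_groundState_re_expect_fermionSpinDot_add_unitVec_nonpos (hd : 0 < d)
    {t U : ℝ} (ht : t ≠ 0) (hU : 0 < U) :
    ∃ (Ls : ℕ → ℕ) (ψ : ∀ L, Fock (Orb (FermionTorus d L))) (ω : InfVolFermionState d),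
      Tendsto Ls atTop atTop ∧ (∀ j, Even (Ls j)) ∧
      (∀ j, IsGroundState (hamiltonian (fermionTorusGraph d (Ls j)) t U) (Ls j ^ d) (ψ (Ls j))) ∧
      ω.IsTorusLimitOf ψ Ls ∧
      ∀ (Λ : Finset (Site d)) (x : Site d) (i : Fin d) (hx : x ∈ Λ) (hxe : x + unitVec i ∈ Λ),
        (ω.expect Λ (fermionSpinDot (PolySite.pt x hx) (PolySite.pt (x + unitVec i) hxe))).re ≤ 0 := by
  obtain ⟨Ls, ψ, ω, hLs, hev, hψ, -, hω⟩ := LiebHalfFilled.exists_isTorusLimitOf_groundState_pow hd ht hU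
  exact ⟨Ls, ψ, ω, hLs, hev, hψ, hω, fun Λ x i hx hxe =>
    torusLimit_re_expect_fermionSpinDot_add_unitVec_nonpos hd ht hU hev hψ hω
      i hx hxe⟩

end Limit

end Literature.MathematicalPhysics.QuantumLattice
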